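import Literature.Combinatorics.SimpleGraph.PaleySosProofs
import Literature.Combinatorics.SimpleGraph.KYAssembly
import HarnessLib

/-!
# Kunisky–Yu 2022, Theorem 1.2 from Theorem 3.35: `SOS₄(G_p) ≥ c p^{1/3}` modulo the 4-cycle bound

The last step of this formalisation of Kunisky–Yu 2022 (arXiv:2211.02713). Everything in the proof
of
Theorem 1.2 except the norm bound for the graph matrix `T^{4,4,1}` (KY Theorem 3.35,
`‖T^{4,4,1}‖ = O(p^{5/4})`, proved there from sums of products of four Kloosterman sums
[FKM15, Cor. 3.2] and [Liu02] — Deligne–Katz level inputs absent from Mathlib) has been formalised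
for
arbitrary conference graphs (`KYAssembly.lean`). Here we specialise to the Paley graph and obtain
the
named fact `kuniskyYu2022_theorem_1_2` of `PaleySos.lean` CONDITIONALLY on that one bound, stated in
quadratic-form language:

* `kuniskyYu2022_theorem_1_2_of_T441` — if for some `C` and every prime `p ≡ 1 (mod 4)` the 4-cycle
  form
  `Θ_p(Vm) = Σ_{a,b,c,d} Vm_{ab}Vm_{cd} S_{ac}S_{ad}S_{bc}S_{bd}` (`S` the Seidel matrix of `G_p`,
  `S_{xy} = χ(x − y)`; `Θ_p(Vm) = 4vᵀT^{4,4,1}v` for the pair vector `v`, so KY Theorem 3.35 gives the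
  hypothesis with `2C` in place of the norm constant) satisfies `|Θ_p(Vm)| ≤ C p^{5/4} ‖Vm‖_F²` for
  all
  symmetric zero-diagonal `Vm`, then `kuniskyYu2022_theorem_1_2` holds, with `c = 2⁻¹⁰/(1+|C|)²`.

Proof: for `p^{1/3} ≤ 1/c` the bound is `≤ 1 ≤ las⁽²⁾` (a vertex is a stable set); otherwise apply
`conference_card_mul_le_lasserreStableBound_two` with `α = c p^{-2/3}` (all smallness conditions hold
exactly in this range) and `K = C p^{5/4}`, using `S𝟙 = 0`, `S² = pI − J` from
`PaleySosProofs.lean`.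

## References

* [KuniskyYu2022] D. Kunisky, X. Yu, arXiv:2211.02713, Theorems 1.2, 3.1, 3.35, (26), (112)–(113).
-/

noncomputable section

namespace Literature.Combinatorics.SimpleGraph

open Matrix Finset

/-- Powers of the twelfth root: `(P^{1/12})ⁿ = P^{n/12}`. [folklore] -/
theorem rpow_twelfth_pow {P : ℝ} (hP : 0 ≤ P) (n : ℕ) :
    (P ^ ((1 : ℝ) / 12)) ^ n = P ^ ((n : ℝ) / 12) := by
  rw [← Real.rpow_natCast, ← Real.rpow_mul hP]
  congr 1
  ring

/-- `las⁽²⁾(G) ≥ 1` for a graph with a vertex (a single vertex is a stable set). [folklore] -/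
theorem one_le_lasserreStableBound_two {V : Type*} [Fintype V] [DecidableEq V]
    (G : _root_.SimpleGraph V) (v : V) : (1 : ℝ) ≤ lasserreStableBound G 2 := by
  have hind : G.IsIndepSet (({v} : Finset V) : Set V) := by
    rw [coe_singleton]; exact Set.pairwise_singleton v _
  have h := (isNonnegLasserreFeasible_subsetIndicator 2 hind).toIsLasserreFeasible
    |>.sum_singleton_le_lasserreStableBound (by norm_num)
  rwa [sum_subsetIndicator_singleton, card_singleton, Nat.cast_one] at h

open Classical in
/-- **Kunisky–Yu 2022, Theorem 1.2, conditionally on Theorem 3.35.** If the 4-cycle graph-matrix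
form
of the Paley graphs satisfies `|Θ_p(Vm)| ≤ C p^{5/4} ‖Vm‖_F²` for all symmetric zero-diagonal `Vm`
(`Θ_p(Vm) = Σ Vm_{ab}Vm_{cd}S_{ac}S_{ad}S_{bc}S_{bd}`, `S_{xy} = 0, +1, −1` as `x = y`, `x ∼ y`, `x
≁ y`
in `G_p`; this is `‖T^{4,4,1}‖ = O(p^{5/4})`, KY Theorem 3.35, in quadratic-form language), then
`SOS₄(G_p) = las⁽²⁾(Ḡ_p) ≥ c p^{1/3}` for all primes `p ≡ 1 (mod 4)`.
[cite: KuniskyYu2022, Theorem 1.2 and Theorem 3.35] -/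
theorem kuniskyYu2022_theorem_1_2_of_T441
    (hT : ∃ C : ℝ, ∀ p : ℕ, p.Prime → p % 4 = 1 →
      ∀ Vm : Matrix (Fin p) (Fin p) ℝ, Vmᵀ = Vm → (∀ x, Vm x x = 0) →
        |∑ a, ∑ b, ∑ c, ∑ d, Vm a b * Vm c d *
          ((if a = c then 0 else if (paleyGraph p).Adj a c then (1 : ℝ) else -1) *
            (if a = d then 0 else if (paleyGraph p).Adj a d then (1 : ℝ) else -1) *
            (if b = c then 0 else if (paleyGraph p).Adj b c then (1 : ℝ) else -1) *
            (if b = d then 0 else if (paleyGraph p).Adj b d then (1 : ℝ) else -1))| ≤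
          C * (p : ℝ) ^ ((5 : ℝ) / 4) * ∑ a, ∑ b, Vm a b ^ 2) :
    kuniskyYu2022_theorem_1_2 := by
  obtain ⟨C, hC⟩ := hT
  set d : ℝ := 1 / 32 / (1 + |C|) with hd
  have hd0 : 0 < d := by positivity
  have hd1 : d ≤ 1 / 32 := by
    rw [hd, div_le_iff₀ (by positivity)]
    nlinarith [abs_nonneg C]
  have hdC : d ^ 4 * |C| ≤ 1 / 16384 := by
    have h1 : d * (1 + |C|) = 1 / 32 := by rw [hd]; field_simp
    have h2 : d * |C| ≤ 1 / 32 := by nlinarith [abs_nonneg C]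
    have h3 : d ^ 3 ≤ (1 / 32) ^ 3 := by gcongr
    calc d ^ 4 * |C| = d ^ 3 * (d * |C|) := by ring
      _ ≤ (1 / 32) ^ 3 * (1 / 32) := mul_le_mul h3 h2 (by positivity) (by positivity)
      _ ≤ 1 / 16384 := by norm_num
  refine ⟨d ^ 2, by positivity, fun p hp hp4 => ?_⟩
  obtain ⟨m, rfl⟩ : ∃ m, p = m + 1 := ⟨p - 1, (Nat.succ_pred_eq_of_pos hp.pos).symm⟩
  haveI : Fact (m + 1).Prime := ⟨hp⟩
  set P : ℝ := ((m + 1 : ℕ) : ℝ) with hP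
  have hP1 : 1 ≤ P := by rw [hP]; exact_mod_cast hp.one_lt.le
  have hP0 : 0 ≤ P := by linarith
  set r : ℝ := P ^ ((1 : ℝ) / 12) with hr
  have hr1 : 1 ≤ r := Real.one_le_rpow hP1 (by norm_num)
  have hr0 : 0 < r := by linarith
  have hr12 : r ^ 12 = P := by rw [hr, rpow_twelfth_pow hP0]; norm_num
  have hr4 : P ^ ((1 : ℝ) / 3) = r ^ 4 := by rw [hr, rpow_twelfth_pow hP0]; norm_num
  have hr6 : Real.sqrt P = r ^ 6 := by
    rw [hr, rpow_twelfth_pow hP0, Real.sqrt_eq_rpow]; norm_num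
  have hr15 : P ^ ((5 : ℝ) / 4) = r ^ 15 := by rw [hr, rpow_twelfth_pow hP0]; norm_num
  rw [hr4]
  by_cases hbig : 1 ≤ d * r ^ 2
  swap
  · -- small `p`: `d² r⁴ ≤ 1 ≤ las⁽²⁾`
    have hsmall : d ^ 2 * r ^ 4 ≤ 1 := by
      have h0 : 0 ≤ d * r ^ 2 := by positivity
      have hlt : d * r ^ 2 < 1 := lt_of_not_ge hbig
      nlinarith
    exact hsmall.trans (one_le_lasserreStableBound_two _ (0 : Fin (m + 1)))
  -- large `p`: the conference-graph theorem with `α = d²/r⁸`, `K = C r¹⁵`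
  set S : Matrix (Fin (m + 1)) (Fin (m + 1)) ℝ :=
    of fun x y => if x = y then 0 else if (paleyGraph (m + 1)).Adj x y then 1 else -1 with hSdef
  have hS : ∀ a b, S a b = if a = b then 0 else if (paleyGraph (m + 1)).Adj a b then 1 else -1 :=
    fun a b => rfl
  have hrow : ∀ a : Fin (m + 1), ∑ b, S a b = 0 := fun a => sum_paley_seidel m hp4 hS a
  have hsq := paley_seidel_mul_self m hp4 hS
  set α : ℝ := d ^ 2 * (r ^ 8)⁻¹ with hα
  have hα0 : 0 < α := by positivity
  have hcard : (Fintype.card (Fin (m + 1)) : ℝ) = P := by rw [Fintype.card_fin]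
  have hinv2 : (r ^ 2)⁻¹ ≤ d := by
    rw [inv_le_iff_one_le_mul₀ (by positivity)]
    linarith [hbig]
  have hri : 0 < (r ^ 2)⁻¹ := by positivity
  have h8 : (r ^ 8)⁻¹ = ((r ^ 2)⁻¹) ^ 4 := by rw [← inv_pow]; ring
  -- the five smallness conditions
  have h1 : α ≤ 1 / 1024 := by
    have : (r ^ 8)⁻¹ ≤ 1 := inv_le_one_of_one_le₀ (one_le_pow₀ hr1)
    calc α = d ^ 2 * (r ^ 8)⁻¹ := rfl
      _ ≤ (1 / 32) ^ 2 * 1 := mul_le_mul (by gcongr) this (by positivity) (by positivity)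
      _ = 1 / 1024 := by norm_num
  have h2 : α * Real.sqrt (Fintype.card (Fin (m + 1))) ≤ 1 / 32768 := by
    rw [hcard, hr6]
    have e : α * r ^ 6 = d ^ 2 * (r ^ 2)⁻¹ := by
      rw [hα]; field_simp
    rw [e]
    calc d ^ 2 * (r ^ 2)⁻¹ ≤ (1 / 32) ^ 2 * (1 / 32) :=
          mul_le_mul (by gcongr) (hinv2.trans hd1) hri.le (by positivity)
      _ = 1 / 32768 := by norm_num
  have h3 : α ^ 2 * Fintype.card (Fin (m + 1)) ≤ 1 / 2 ^ 30 := by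
    rw [hcard, ← hr12]
    have e : α ^ 2 * r ^ 12 = d ^ 4 * ((r ^ 2)⁻¹) ^ 2 := by
      rw [hα]; field_simp
    rw [e]
    calc d ^ 4 * ((r ^ 2)⁻¹) ^ 2 ≤ (1 / 32) ^ 4 * (1 / 32) ^ 2 :=
          mul_le_mul (by gcongr) (by gcongr; exact hinv2.trans hd1) (by positivity) (by positivity)
      _ = 1 / 2 ^ 30 := by norm_num
  have h4 : α ^ 3 * (Fintype.card (Fin (m + 1)) : ℝ) ^ 2 ≤ 1 / 2 ^ 30 := by
    rw [hcard, ← hr12]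
    have e : α ^ 3 * (r ^ 12) ^ 2 = d ^ 6 := by
      rw [hα]; field_simp
    rw [e]
    calc d ^ 6 ≤ (1 / 32) ^ 6 := by gcongr
      _ = 1 / 2 ^ 30 := by norm_num
  have h5 : 1 ≤ α ^ 2 * (Fintype.card (Fin (m + 1)) : ℝ) ^ 2 := by
    rw [hcard, ← hr12]
    have e : α ^ 2 * (r ^ 12) ^ 2 = (d * r ^ 2) ^ 4 := by
      rw [hα]; field_simp
    rw [e]
    exact one_le_pow₀ hbig
  have hK : α ^ 2 * (C * r ^ 15) ≤ 1 / 16384 := by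
    have e : α ^ 2 * (C * r ^ 15) = d ^ 4 * C * r⁻¹ := by
      rw [hα]; field_simp
    rw [e]
    have hri1 : r⁻¹ ≤ 1 := inv_le_one_of_one_le₀ hr1
    calc d ^ 4 * C * r⁻¹ ≤ |d ^ 4 * C * r⁻¹| := le_abs_self _
      _ = d ^ 4 * |C| * r⁻¹ := by
          rw [abs_mul, abs_mul, abs_of_nonneg (by positivity : 0 ≤ d ^ 4),
            abs_of_nonneg (by positivity : 0 ≤ r⁻¹)]
      _ ≤ d ^ 4 * |C| * 1 := mul_le_mul_of_nonneg_left hri1 (by positivity)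
      _ ≤ 1 / 16384 := by rw [mul_one]; exact hdC
  have hΘ : ∀ Vm : Matrix (Fin (m + 1)) (Fin (m + 1)) ℝ, (∀ x y, Vm x y = Vm y x) →
      (∀ x, Vm x x = 0) →
      |∑ a, ∑ b, ∑ c, ∑ d, Vm a b * Vm c d * (S a c * S a d * S b c * S b d)| ≤
        (C * r ^ 15) * ∑ a, ∑ b, Vm a b ^ 2 := by
    intro Vm hVs hVd
    have hVt : Vmᵀ = Vm := by ext x y; rw [transpose_apply]; exact hVs y x
    have h := hC (m + 1) hp hp4 Vm hVt hVd
    rw [← hP, hr15] at h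
    simpa only [hS, mul_assoc] using h
  have hmain := conference_card_mul_le_lasserreStableBound_two (paleyGraph (m + 1)) hS hrow hsq hα0
    h1 h2 h3 h4 h5 hK hΘ
  rw [hcard] at hmain
  have e : P * α = d ^ 2 * r ^ 4 := by
    rw [← hr12, hα]; field_simp
  rw [e] at hmain
  exact hmain

end Literature.Combinatorics.SimpleGraph

end
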